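import Summits.QuantumFields.YangMills.Theorems.AllWindowsColdBoxBulkMidSandwichSubGaussianTail

/-!
# CONCENTRATION of linear statistics under the `H₀`-sandwich — Gaussian tails and the union bound
# (crux idea `logconcave-core-extension` on ⟨stmt-QuantumFields-24006⟩, piece P3(b) packaged: "mass of the surrogate off the core")

For `H₀ ≻ 0` and `A ∈ C²(ℝⁿ)` with the two-sided sandwich `(1±δ)hᵀH₀h` (`δ < 1`), `Z = ∫e^{−A}`, `m_b = ∫(x·b)e^{−A}/Z`,
`σ_b² = bᵀH₀⁻¹b/(1−δ)`:
* `exists_quadratic_lower_of_lower_sandwich_posDef` / `integrable_tilt_posDef`: Gaussian domination in the `H₀` frame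
  (only the LOWER half of the sandwich is used);
* `tail_le_of_sandwich_posDef`: `∫_{a ≤ x·b − m_b} e^{−A} ≤ exp(−ta + t²σ_b²/2)·Z` for every `t ≥ 0` (Chernoff);
* `absTail_le_of_sandwich_posDef`: `∫_{a ≤ |x·b − m_b|} e^{−A} ≤ 2·exp(−a²/(2σ_b²))·Z` for `a ≥ 0`, `σ_b² > 0`;
* `unionTail_le_of_sandwich_posDef`: for a finite family `(b_j, a_j)`,
  `∫_{⋃_j {a_j ≤ |x·b_j − m_j|}} e^{−A} ≤ (Σ_j 2·exp(−a_j²/(2σ_j²)))·Z` — the form in which P3(b) of the card books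
  `μ_A(Kᶜ) ≤ #statistics · e^{−cβ^{2ε}}`.

HONEST SCOPE.  Free-hands work of the LEAD seat of ⟨stmt-QuantumFields-24006⟩ (FCL lineage) on an ingredient of an
UN-TRIAGED crux idea card; classical log-concave probability.  No stub of LINE-18, no crux, rung or summit is proved; the
Yang–Mills mass gap is NOT proved by any of this.
-/

noncomputable section

namespace Summit.QuantumFields.YangMills.Theorems.SandwichVariancePinching

open MeasureTheory Real Filter Topology Set Matrix

variable {n : ℕ}

/-! ## §1 Gaussian domination in the `H₀` frame -/

/-- QUADRATIC LOWER BOUND from the LOWER `H₀`-sandwich (`δ < 1`, `H₀ ≻ 0`): `−C(1+‖x‖) + κ‖x‖² ≤ A(x)`. [folklore] -/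
theorem exists_quadratic_lower_of_lower_sandwich_posDef {H₀ : Matrix (Fin n) (Fin n) ℝ} (hH₀ : H₀.PosDef)
    {A : (Fin n → ℝ) → ℝ} (hA : Continuous A) {δ : ℝ} (hδ1 : δ < 1)
    (hlow : ∀ x h : Fin n → ℝ, (1 - δ) * (h ⬝ᵥ H₀.mulVec h) ≤ A (x + h) + A (x - h) - 2 * A x) :
    ∃ C κ : ℝ, 0 ≤ C ∧ 0 < κ ∧ ∀ x, -C * (1 + ‖x‖) + κ * ‖x‖ ^ 2 ≤ A x := by
  set c : ℝ := (1 - δ) / 2 with hc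
  have hc0 : 0 < c := by rw [hc]; linarith
  set g : (Fin n → ℝ) → ℝ := fun x => A x - c * (x ⬝ᵥ H₀.mulVec x) with hgdef
  have hgcont : Continuous g :=
    hA.sub (continuous_const.mul (continuous_id.dotProduct
      ((Matrix.mulVecLin H₀).toContinuousLinearMap.continuous)))
  have hsymm : ∀ u v : Fin n → ℝ, u ⬝ᵥ H₀.mulVec v = v ⬝ᵥ H₀.mulVec u := fun u v => by
    have hH : H₀.IsHermitian := hH₀.isHermitian
    have hT : H₀ᵀ = H₀ := by
      have := hH; rw [Matrix.IsHermitian, Matrix.conjTranspose_eq_transpose_of_trivial] at this; exact this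
    rw [Matrix.dotProduct_mulVec, ← Matrix.mulVec_transpose, hT, dotProduct_comm]
  have hg2 : ∀ x h : Fin n → ℝ, 2 * g x ≤ g (x + h) + g (x - h) := by
    intro x h
    have h1 := hlow x h
    have hq : (x + h) ⬝ᵥ H₀.mulVec (x + h) + (x - h) ⬝ᵥ H₀.mulVec (x - h) =
        2 * (x ⬝ᵥ H₀.mulVec x) + 2 * (h ⬝ᵥ H₀.mulVec h) := by
      simp only [Matrix.mulVec_add, Matrix.mulVec_sub, add_dotProduct, sub_dotProduct, dotProduct_add,
        dotProduct_sub, hsymm h x]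
      ring
    simp only [hgdef]
    have : c * ((x + h) ⬝ᵥ H₀.mulVec (x + h)) + c * ((x - h) ⬝ᵥ H₀.mulVec (x - h)) =
        2 * (c * (x ⬝ᵥ H₀.mulVec x)) + (1 - δ) * (h ⬝ᵥ H₀.mulVec h) := by
      rw [← mul_add, hq, hc]; ring
    linarith
  obtain ⟨C, hC0, hClb⟩ := exists_linear_lower_of_secondDiff_nonneg hgcont hg2
  obtain ⟨lam, hlam, hlamle⟩ := exists_pos_mul_norm_sq_le hH₀
  refine ⟨C, c * lam, hC0, mul_pos hc0 hlam, fun x => ?_⟩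
  have h1 := hClb x
  have h2 : lam * ‖x‖ ^ 2 ≤ x ⬝ᵥ H₀.mulVec x := hlamle x
  have h3 : A x = g x + c * (x ⬝ᵥ H₀.mulVec x) := by simp [hgdef]
  rw [h3]
  nlinarith [mul_le_mul_of_nonneg_left h2 hc0.le]

/-- INTEGRABILITY of `w·e^{s·(x·b) − A}` in the `H₀` frame for continuous polynomially bounded `w` (degree `≤ 8`). [folklore] -/
theorem integrable_tilt_posDef {H₀ : Matrix (Fin n) (Fin n) ℝ} (hH₀ : H₀.PosDef)
    {A : (Fin n → ℝ) → ℝ} (hA : Continuous A) {δ : ℝ} (hδ1 : δ < 1)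
    (hlow : ∀ x h : Fin n → ℝ, (1 - δ) * (h ⬝ᵥ H₀.mulVec h) ≤ A (x + h) + A (x - h) - 2 * A x)
    (b : Fin n → ℝ) (s : ℝ) {w : (Fin n → ℝ) → ℝ} (hw : Continuous w) {D : ℝ} {k : ℕ} (hk : k ≤ 8)
    (hwb : ∀ x, |w x| ≤ D * (1 + ‖x‖) ^ k) :
    Integrable fun x => w x * exp (s * (x ⬝ᵥ b) - A x) := by
  have hAs : Continuous fun x => A x - s * (x ⬝ᵥ b) :=
    hA.sub (continuous_const.mul (continuous_id.dotProduct continuous_const))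
  have hlows : ∀ x h : Fin n → ℝ, (1 - δ) * (h ⬝ᵥ H₀.mulVec h) ≤
      (A (x + h) - s * ((x + h) ⬝ᵥ b)) + (A (x - h) - s * ((x - h) ⬝ᵥ b)) - 2 * (A x - s * (x ⬝ᵥ b)) := by
    intro x h
    have e : (A (x + h) - s * ((x + h) ⬝ᵥ b)) + (A (x - h) - s * ((x - h) ⬝ᵥ b)) - 2 * (A x - s * (x ⬝ᵥ b))
        = A (x + h) + A (x - h) - 2 * A x := by
      simp only [add_dotProduct, sub_dotProduct]; ring
    rw [e]; exact hlow x h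
  obtain ⟨C, κ, _, hκ, hlb⟩ := exists_quadratic_lower_of_lower_sandwich_posDef hH₀ hAs hδ1 hlows
  have h := integrable_mul_exp_neg_of_growth hAs hw hκ hk hlb hwb
  refine h.congr (ae_of_all _ fun x => ?_)
  simp only [exp_neg_tilt]

/-! ## §2 Tails in the `H₀` metric -/

/-- **CHERNOFF TAIL in the `H₀` metric** (`A ∈ C²`, two-sided sandwich, `δ < 1`, `t ≥ 0`):
`∫_{a ≤ x·b − m} e^{−A} ≤ exp(−t·a + t²·bᵀH₀⁻¹b/(2(1−δ)))·∫e^{−A}`. [folklore] -/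
theorem tail_le_of_sandwich_posDef {H₀ : Matrix (Fin n) (Fin n) ℝ} (hH₀ : H₀.PosDef)
    {A : (Fin n → ℝ) → ℝ} (hA : ContDiff ℝ 2 A) {δ : ℝ} (hδ1 : δ < 1)
    (hsw : ∀ x h : Fin n → ℝ, (1 - δ) * (h ⬝ᵥ H₀.mulVec h) ≤ A (x + h) + A (x - h) - 2 * A x ∧
      A (x + h) + A (x - h) - 2 * A x ≤ (1 + δ) * (h ⬝ᵥ H₀.mulVec h)) (b : Fin n → ℝ) (a : ℝ) {t : ℝ}
    (ht : 0 ≤ t) :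
    ∫ x in {x | a ≤ x ⬝ᵥ b - (∫ y, (y ⬝ᵥ b) * exp (-A y)) / ∫ y, exp (-A y)}, exp (-A x) ≤
      exp (-(t * a) + t ^ 2 / 2 * ((b ⬝ᵥ H₀⁻¹.mulVec b) / (1 - δ))) * ∫ x, exp (-A x) := by
  have hAc : Continuous A := hA.continuous
  have hlow := fun x h => (hsw x h).1
  set m : ℝ := (∫ y, (y ⬝ᵥ b) * exp (-A y)) / ∫ y, exp (-A y) with hm
  set S : Set (Fin n → ℝ) := {x | a ≤ x ⬝ᵥ b - m} with hS
  have hSm : MeasurableSet S :=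
    (isClosed_le continuous_const ((continuous_id.dotProduct continuous_const).sub
      continuous_const)).measurableSet
  have hI0 : Integrable fun x => exp (-A x) := by
    have := integrable_tilt_posDef hH₀ hAc hδ1 hlow b 0 continuous_const (w := fun _ => (1:ℝ)) (D := 1)
      (k := 0) (by norm_num) (fun x => by simp)
    simpa using this
  have hIt : Integrable fun x => exp (t * (x ⬝ᵥ b) - A x) := by
    have := integrable_tilt_posDef hH₀ hAc hδ1 hlow b t continuous_const (w := fun _ => (1:ℝ)) (D := 1)
      (k := 0) (by norm_num) (fun x => by simp)
    simpa using this
  have hpt : ∀ x, S.indicator (fun x => exp (-A x)) x ≤ exp (-(t * (m + a))) * exp (t * (x ⬝ᵥ b) - A x) := by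
    intro x
    by_cases hx : x ∈ S
    · rw [indicator_of_mem hx, ← Real.exp_add]
      refine exp_le_exp.mpr ?_
      have hx' : a ≤ x ⬝ᵥ b - m := hx
      nlinarith
    · rw [indicator_of_notMem hx]
      positivity
  calc ∫ x in S, exp (-A x) = ∫ x, S.indicator (fun x => exp (-A x)) x := (integral_indicator hSm).symm
    _ ≤ ∫ x, exp (-(t * (m + a))) * exp (t * (x ⬝ᵥ b) - A x) :=
        integral_mono (hI0.indicator hSm) (hIt.const_mul _) hpt
    _ = exp (-(t * (m + a))) * ∫ x, exp (t * (x ⬝ᵥ b) - A x) := integral_const_mul _ _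
    _ ≤ exp (-(t * (m + a))) *
        (exp (t * m + t ^ 2 / 2 * ((b ⬝ᵥ H₀⁻¹.mulVec b) / (1 - δ))) * ∫ x, exp (-A x)) :=
        mul_le_mul_of_nonneg_left (expMoment_le_of_sandwich_posDef hH₀ hA hδ1 hsw b t) (exp_pos _).le
    _ = exp (-(t * a) + t ^ 2 / 2 * ((b ⬝ᵥ H₀⁻¹.mulVec b) / (1 - δ))) * ∫ x, exp (-A x) := by
        rw [← mul_assoc, ← Real.exp_add]
        congr 2
        ring

/-- **TWO-SIDED GAUSSIAN TAIL in the `H₀` metric** (`a ≥ 0`, `σ² = bᵀH₀⁻¹b/(1−δ) > 0`):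
`∫_{a ≤ |x·b − m|} e^{−A} ≤ 2·exp(−a²/(2σ²))·∫e^{−A}`. [folklore] -/
theorem absTail_le_of_sandwich_posDef {H₀ : Matrix (Fin n) (Fin n) ℝ} (hH₀ : H₀.PosDef)
    {A : (Fin n → ℝ) → ℝ} (hA : ContDiff ℝ 2 A) {δ : ℝ} (hδ1 : δ < 1)
    (hsw : ∀ x h : Fin n → ℝ, (1 - δ) * (h ⬝ᵥ H₀.mulVec h) ≤ A (x + h) + A (x - h) - 2 * A x ∧
      A (x + h) + A (x - h) - 2 * A x ≤ (1 + δ) * (h ⬝ᵥ H₀.mulVec h)) (b : Fin n → ℝ) {a : ℝ} (ha : 0 ≤ a)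
    (hσ : 0 < (b ⬝ᵥ H₀⁻¹.mulVec b) / (1 - δ)) :
    ∫ x in {x | a ≤ |x ⬝ᵥ b - (∫ y, (y ⬝ᵥ b) * exp (-A y)) / ∫ y, exp (-A y)|}, exp (-A x) ≤
      2 * exp (-(a ^ 2 / (2 * ((b ⬝ᵥ H₀⁻¹.mulVec b) / (1 - δ))))) * ∫ x, exp (-A x) := by
  have hAc : Continuous A := hA.continuous
  have hlow := fun x h => (hsw x h).1
  set σ2 : ℝ := (b ⬝ᵥ H₀⁻¹.mulVec b) / (1 - δ) with hσ2
  set m : ℝ := (∫ y, (y ⬝ᵥ b) * exp (-A y)) / ∫ y, exp (-A y) with hm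
  have hI0 : Integrable fun x => exp (-A x) := by
    have := integrable_tilt_posDef hH₀ hAc hδ1 hlow b 0 continuous_const (w := fun _ => (1:ℝ)) (D := 1)
      (k := 0) (by norm_num) (fun x => by simp)
    simpa using this
  -- the upper tail with the optimal `t = a/σ²`
  set t : ℝ := a / σ2 with htdef
  have ht : 0 ≤ t := div_nonneg ha hσ.le
  have hexp : -(t * a) + t ^ 2 / 2 * σ2 = -(a ^ 2 / (2 * σ2)) := by
    rw [htdef]; field_simp; ring
  have hup : ∫ x in {x | a ≤ x ⬝ᵥ b - m}, exp (-A x) ≤ exp (-(a ^ 2 / (2 * σ2))) * ∫ x, exp (-A x) := by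
    have h := tail_le_of_sandwich_posDef hH₀ hA hδ1 hsw b a ht
    rw [hexp] at h
    exact h
  -- the lower tail = the upper tail of `−b`
  have hneg : (∫ y, (y ⬝ᵥ (-b)) * exp (-A y)) / (∫ y, exp (-A y)) = -m := by
    rw [hm, ← neg_div, ← integral_neg]
    congr 1
    refine integral_congr_ae (ae_of_all _ fun y => ?_)
    simp only [dotProduct_neg]; ring
  have hσneg : ((-b) ⬝ᵥ H₀⁻¹.mulVec (-b)) / (1 - δ) = σ2 := by
    rw [hσ2, Matrix.mulVec_neg, neg_dotProduct, dotProduct_neg, neg_neg]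
  have hlo : ∫ x in {x | a ≤ -(x ⬝ᵥ b - m)}, exp (-A x) ≤ exp (-(a ^ 2 / (2 * σ2))) * ∫ x, exp (-A x) := by
    have h := tail_le_of_sandwich_posDef hH₀ hA hδ1 hsw (-b) a ht
    rw [hneg, hσneg, hexp] at h
    have e : {x : Fin n → ℝ | a ≤ x ⬝ᵥ (-b) - -m} = {x | a ≤ -(x ⬝ᵥ b - m)} := by
      ext x; simp only [mem_setOf_eq, dotProduct_neg]; constructor <;> intro h' <;> linarith
    rw [e] at h
    exact h
  -- union bound via indicators
  set S₁ : Set (Fin n → ℝ) := {x | a ≤ x ⬝ᵥ b - m} with hS₁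
  set S₂ : Set (Fin n → ℝ) := {x | a ≤ -(x ⬝ᵥ b - m)} with hS₂
  set S : Set (Fin n → ℝ) := {x | a ≤ |x ⬝ᵥ b - m|} with hS
  have hlin : Continuous fun x : Fin n → ℝ => x ⬝ᵥ b - m :=
    (continuous_id.dotProduct continuous_const).sub continuous_const
  have hS₁m : MeasurableSet S₁ := (isClosed_le continuous_const hlin).measurableSet
  have hS₂m : MeasurableSet S₂ := (isClosed_le continuous_const hlin.neg).measurableSet
  have hSm : MeasurableSet S := (isClosed_le continuous_const hlin.abs).measurableSet
  have hpt : ∀ x, S.indicator (fun x => exp (-A x)) x ≤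
      S₁.indicator (fun x => exp (-A x)) x + S₂.indicator (fun x => exp (-A x)) x := by
    intro x
    have h1 : 0 ≤ S₁.indicator (fun x => exp (-A x)) x :=
      Set.indicator_nonneg (fun y _ => (exp_pos _).le) x
    have h2 : 0 ≤ S₂.indicator (fun x => exp (-A x)) x :=
      Set.indicator_nonneg (fun y _ => (exp_pos _).le) x
    by_cases hx : x ∈ S
    · rw [indicator_of_mem hx]
      have hx' : a ≤ |x ⬝ᵥ b - m| := hx
      rcases le_or_gt 0 (x ⬝ᵥ b - m) with h0 | h0
      · have hx1 : x ∈ S₁ := by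
          show a ≤ x ⬝ᵥ b - m
          rwa [abs_of_nonneg h0] at hx'
        rw [indicator_of_mem hx1]; linarith
      · have hx2 : x ∈ S₂ := by
          show a ≤ -(x ⬝ᵥ b - m)
          rwa [abs_of_neg h0] at hx'
        rw [indicator_of_mem hx2]; linarith
    · rw [indicator_of_notMem hx]; linarith
  calc ∫ x in S, exp (-A x) = ∫ x, S.indicator (fun x => exp (-A x)) x := (integral_indicator hSm).symm
    _ ≤ ∫ x, (S₁.indicator (fun x => exp (-A x)) x + S₂.indicator (fun x => exp (-A x)) x) :=
        integral_mono (hI0.indicator hSm) ((hI0.indicator hS₁m).add (hI0.indicator hS₂m)) hpt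
    _ = (∫ x in S₁, exp (-A x)) + ∫ x in S₂, exp (-A x) := by
        rw [integral_add (hI0.indicator hS₁m) (hI0.indicator hS₂m), integral_indicator hS₁m,
          integral_indicator hS₂m]
    _ ≤ 2 * exp (-(a ^ 2 / (2 * σ2))) * ∫ x, exp (-A x) := by linarith [hup, hlo]

/-! ## §3 The union bound over a finite family of linear statistics -/

/-- **UNION OF GAUSSIAN TAILS** over a finite family `(b_j, a_j)_{j ∈ J}` (`a_j ≥ 0`, `σ_j² = b_jᵀH₀⁻¹b_j/(1−δ) > 0`):
`∫_{⋃_j {a_j ≤ |x·b_j − m_j|}} e^{−A} ≤ (Σ_j 2·exp(−a_j²/(2σ_j²)))·∫e^{−A}` — the mass of the surrogate off a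
core cut out by finitely many linear statistics. [folklore] -/
theorem unionTail_le_of_sandwich_posDef {H₀ : Matrix (Fin n) (Fin n) ℝ} (hH₀ : H₀.PosDef)
    {A : (Fin n → ℝ) → ℝ} (hA : ContDiff ℝ 2 A) {δ : ℝ} (hδ1 : δ < 1)
    (hsw : ∀ x h : Fin n → ℝ, (1 - δ) * (h ⬝ᵥ H₀.mulVec h) ≤ A (x + h) + A (x - h) - 2 * A x ∧
      A (x + h) + A (x - h) - 2 * A x ≤ (1 + δ) * (h ⬝ᵥ H₀.mulVec h))
    {ι : Type*} (J : Finset ι) (b : ι → Fin n → ℝ) (a : ι → ℝ) (ha : ∀ j ∈ J, 0 ≤ a j)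
    (hσ : ∀ j ∈ J, 0 < (b j ⬝ᵥ H₀⁻¹.mulVec (b j)) / (1 - δ)) :
    ∫ x in ⋃ j ∈ J, {x | a j ≤ |x ⬝ᵥ b j - (∫ y, (y ⬝ᵥ b j) * exp (-A y)) / ∫ y, exp (-A y)|}, exp (-A x) ≤
      (∑ j ∈ J, 2 * exp (-(a j ^ 2 / (2 * ((b j ⬝ᵥ H₀⁻¹.mulVec (b j)) / (1 - δ)))))) * ∫ x, exp (-A x) := by
  classical
  have hAc : Continuous A := hA.continuous
  have hlow := fun x h => (hsw x h).1
  have hI0 : Integrable fun x => exp (-A x) := by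
    have := integrable_tilt_posDef hH₀ hAc hδ1 hlow 0 0 continuous_const (w := fun _ => (1:ℝ)) (D := 1)
      (k := 0) (by norm_num) (fun x => by simp)
    simpa using this
  set m : ι → ℝ := fun j => (∫ y, (y ⬝ᵥ b j) * exp (-A y)) / ∫ y, exp (-A y) with hm
  set S : ι → Set (Fin n → ℝ) := fun j => {x | a j ≤ |x ⬝ᵥ b j - m j|} with hS
  have hSm : ∀ j, MeasurableSet (S j) := fun j =>
    (isClosed_le continuous_const (((continuous_id.dotProduct continuous_const).sub
      continuous_const).abs)).measurableSet
  have hUm : MeasurableSet (⋃ j ∈ J, S j) := Finset.measurableSet_biUnion J fun j _ => hSm j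
  -- pointwise: indicator of the union ≤ sum of indicators
  have hpt : ∀ x, (⋃ j ∈ J, S j).indicator (fun x => exp (-A x)) x ≤
      ∑ j ∈ J, (S j).indicator (fun x => exp (-A x)) x := by
    intro x
    have hnn : ∀ j ∈ J, 0 ≤ (S j).indicator (fun x => exp (-A x)) x := fun j _ =>
      Set.indicator_nonneg (fun y _ => (exp_pos _).le) x
    by_cases hx : x ∈ ⋃ j ∈ J, S j
    · rw [indicator_of_mem hx]
      obtain ⟨j, hj, hxj⟩ : ∃ j ∈ J, x ∈ S j := by simpa only [mem_iUnion, exists_prop] using hx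
      calc exp (-A x) = (S j).indicator (fun x => exp (-A x)) x := (indicator_of_mem hxj (fun x => exp (-A x))).symm
        _ ≤ ∑ j ∈ J, (S j).indicator (fun x => exp (-A x)) x := Finset.single_le_sum hnn hj
    · rw [indicator_of_notMem hx]
      exact Finset.sum_nonneg hnn
  have hint : Integrable fun x => ∑ j ∈ J, (S j).indicator (fun x => exp (-A x)) x :=
    integrable_finsetSum _ fun j _ => hI0.indicator (hSm j)
  calc ∫ x in ⋃ j ∈ J, S j, exp (-A x) = ∫ x, (⋃ j ∈ J, S j).indicator (fun x => exp (-A x)) x :=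
        (integral_indicator hUm).symm
    _ ≤ ∫ x, ∑ j ∈ J, (S j).indicator (fun x => exp (-A x)) x := integral_mono (hI0.indicator hUm) hint hpt
    _ = ∑ j ∈ J, ∫ x in S j, exp (-A x) := by
        rw [integral_finsetSum _ fun j _ => hI0.indicator (hSm j)]
        exact Finset.sum_congr rfl fun j _ => integral_indicator (hSm j)
    _ ≤ ∑ j ∈ J, 2 * exp (-(a j ^ 2 / (2 * ((b j ⬝ᵥ H₀⁻¹.mulVec (b j)) / (1 - δ))))) * ∫ x, exp (-A x) :=
        Finset.sum_le_sum fun j hj => absTail_le_of_sandwich_posDef hH₀ hA hδ1 hsw (b j) (ha j hj) (hσ j hj)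
    _ = (∑ j ∈ J, 2 * exp (-(a j ^ 2 / (2 * ((b j ⬝ᵥ H₀⁻¹.mulVec (b j)) / (1 - δ)))))) * ∫ x, exp (-A x) := by
        rw [Finset.sum_mul]

end Summit.QuantumFields.YangMills.Theorems.SandwichVariancePinching

end
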